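import Literature.NumberTheory.Automorphic.BrandtWeightKJacquetLanglands
import HarnessLib

/-!
# Weight-`k` Brandt eigen-systems: there are none of odd weight (first reduction step for the
# Jacquet–Langlands fact `jacquetLanglands_newform_of_brandtEigenformLite`)

Topic `Literature/NumberTheory/Automorphic`; theorems only (no definition, no named fact, no
instance; D-0026). Proof-only sibling of `BrandtWeightKJacquetLanglands.lean`, whose named fact
`jacquetLanglands_newform_of_brandtEigenformLite` (Dembélé–Voight 2013, Thm. 33 — the
Jacquet–Langlands / Eichler basis-problem correspondence `S_k^B(𝔑) ↪ S_k(𝔇𝔑)` for definite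
quaternion algebras — read for the inline weight-`k` eigen-systems `(k, lam, Φ)` of the tree's
`Brandt.*Lite` package) is a theory-sized (XL) result: its printed proofs compare Eichler's trace
formula for the weight-`k` Brandt matrices `B_{k-2}(n)` with the Eichler–Selberg trace formula
(Eichler, LNM 320 (1973), Ch. II §6–8 and Ch. IV §1–2; Pizer 1980; Hijikata–Pizer–Shemanske 1989,
§7), or go through the representation-theoretic correspondence (Jacquet–Langlands 1970, Ch. 16).
The tree's weight-`2` twin of that comparison is `EllipticCurves/EichlerBasisTheoremOfTraceIdentity`
/ `…OfTraceFormulas` (closed modulo the named fact `HeckeTraceFormulaGL2Level`).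

This file proves the first, elementary reduction of every such proof — **the space of weight-`k`
forms on a definite quaternion algebra over `ℚ` is zero for odd `k`** (Eichler, LNM 320, Ch. II §6,
remark after (16): the Brandt matrices "vanish identically for odd `l`" because `-1` is a unit of
every order; Dembélé–Voight 2013, §7, weights of the same parity): the unit `β = -1 ∈ Bˣ` fixes
every lattice, `(-1) I = I`, and acts on `F[X₀, X₁]_{k-2}` by the substitution `X ↦ -X`, i.e. by
`(-1)^{k-2}`; so the equivariance clause `Φ(βI) = ρ_β Φ(I)` forces `Φ(I) = (-1)^{k-2} Φ(I)`, and
`Φ = 0` on the right ideals when `k - 2` is odd, contradicting the non-vanishing clause.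

* `Brandt.aeval_neg_X_of_isHomogeneous` — `P(-X) = (-1)^d • P` for `P` homogeneous of degree `d`
  (any commutative ring, any variables).
* `Brandt.coeffActionLite_neg_one` — `ρ_{-1} P = P(-X)` for the substitution action through any
  splitting `ι : B → M₂(F)`.
* `Brandt.map_mulLeft_neg_one` — `(-1) I = I` for a `ℤ`-lattice `I ⊆ B`.
* `Brandt.IsWeightEigenformLite.even_sub_two`, `Brandt.IsWeightEigenformLite.even` — a weight-`k`
  Brandt eigen-system has `k - 2` even (hence `k` even once `2 ≤ k`);
  `Brandt.even_of_equivariant_of_ne_zero` is the clause-level statement (homogeneity +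
  equivariance + one non-zero value suffice; no Hecke condition is used).

Consequently the hypotheses of `jacquetLanglands_newform_of_brandtEigenformLite` are
unsatisfiable for odd `k` (where its conclusion would be false: `S_k(Γ₀(N)) = 0` for odd `k`,
`eq_zero_of_odd_weight_gamma0` in `EllipticCurves/Newforms.lean`), and any proof of the fact may
assume `k` even, `k ≥ 4`.

## References

* [Eichler1973] M. Eichler, *The basis problem for modular forms and the traces of the Hecke
  operators*, in: Modular Functions of One Variable I, LNM 320 (1973), 75–151: Ch. II §6
  (Brandt matrices `B_l(n)`; `B_l(n) = 0` for odd `l`), Ch. IV §1–2 (the basis problem)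
  (held: `book:kuijk1973-modular-functions-one-variable-i-…`, PDF pp. 62–65, 84–86).
* [DembeleVoight2013] L. Dembélé, J. Voight, *Explicit methods for Hilbert modular forms*, in:
  Elliptic curves, Hilbert modular forms and Galois deformations, Birkhäuser (2013), §7–8, Thm. 33
  (held: `paper:arxiv-1010.5727`, pp. 23–27).
-/

noncomputable section

open scoped BigOperators

namespace Literature.NumberTheory.Automorphic

namespace Brandt

/-! ### `P(-X) = (-1)^d P` for homogeneous `P` -/

/-- **Homogeneous polynomials are `(-1)^d`-eigenvectors of `X ↦ -X`.** For `φ` homogeneous of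
degree `d` over a commutative ring, substituting `-X_j` for every variable `X_j` multiplies `φ` by
`(-1)^d` (each monomial `X^s` with `|s| = d` picks up `(-1)^{|s|}`). [folklore] -/
theorem aeval_neg_X_of_isHomogeneous {σ R : Type*} [CommRing R] {φ : MvPolynomial σ R} {d : ℕ}
    (hφ : φ.IsHomogeneous d) :
    MvPolynomial.aeval (fun j => -(MvPolynomial.X j : MvPolynomial σ R)) φ = (-1 : R) ^ d • φ := by
  classical
  conv_lhs => rw [φ.as_sum]
  conv_rhs => rw [φ.as_sum]
  rw [map_sum, Finset.smul_sum]
  refine Finset.sum_congr rfl fun s hs => ?_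
  have hdeg : d = ∑ i ∈ s.support, s i := hφ.degree_eq_sum_deg_support hs
  rw [MvPolynomial.aeval_monomial, MvPolynomial.algebraMap_eq, MvPolynomial.smul_eq_C_mul,
    MvPolynomial.monomial_eq, Finsupp.prod, Finsupp.prod]
  have hprod : (∏ i ∈ s.support, (-(MvPolynomial.X i : MvPolynomial σ R)) ^ s i) =
      (-1 : MvPolynomial σ R) ^ d * ∏ i ∈ s.support, (MvPolynomial.X i : MvPolynomial σ R) ^ s i := by
    rw [hdeg, ← Finset.prod_pow_eq_pow_sum, ← Finset.prod_mul_distrib]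
    refine Finset.prod_congr rfl fun i _ => ?_
    rw [neg_pow]
  rw [hprod, map_pow, map_neg, map_one]
  ring

/-! ### The unit `-1`: it fixes every lattice and acts by `X ↦ -X` -/

/-- **`ρ_{-1}` is the substitution `X ↦ -X`**: through any splitting `ι : B → M₂(F)` the unit
`-1 ∈ Bˣ` goes to the matrix `-1`, so `coeffActionLite ι (-1) P = P(-X₀, -X₁)`. [folklore] -/
theorem coeffActionLite_neg_one {B F : Type*} [Ring B] [Field F] [Algebra ℚ B] [Algebra ℚ F]
    (ι : B →ₐ[ℚ] Matrix (Fin 2) (Fin 2) F) (P : MvPolynomial (Fin 2) F) :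
    coeffActionLite ι (-1) P =
      MvPolynomial.aeval (fun j => -(MvPolynomial.X j : MvPolynomial (Fin 2) F)) P := by
  have hι : ι ((-1 : Bˣ) : B) = -1 := by
    rw [Units.val_neg, Units.val_one, map_neg, map_one]
  have hfun : (fun j : Fin 2 => ∑ i : Fin 2,
      MvPolynomial.X (R := F) i * MvPolynomial.C (ι ((-1 : Bˣ) : B) i j)) =
      fun j => -(MvPolynomial.X j : MvPolynomial (Fin 2) F) := by
    funext j
    rw [hι]
    fin_cases j <;> simp [Matrix.one_apply]
  rw [coeffActionLite_def, hfun]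

/-- **`(-1) I = I`**: left multiplication by the unit `-1` maps every `ℤ`-submodule of `B` onto
itself. [folklore] -/
theorem map_mulLeft_neg_one {B : Type*} [Ring B] (I : Submodule ℤ B) :
    I.map (AddMonoidHom.mulLeft ((-1 : Bˣ) : B)).toIntLinearMap = I := by
  have hlin : (AddMonoidHom.mulLeft ((-1 : Bˣ) : B)).toIntLinearMap = -LinearMap.id := by
    ext x
    simp
  rw [hlin, Submodule.map_neg, Submodule.map_id]

/-! ### No eigen-systems of odd weight -/

variable {Nplus Nminus : ℕ}

/-- **Clause-level odd-weight vanishing.** If `Φ` is homogeneous of degree `k - 2` and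
`Bˣ`-equivariant (for the substitution action through `ι`) on the right ideals of `S.O`, and does
not vanish at some right ideal, then `k - 2` is even: at `β = -1` equivariance reads
`Φ(I) = (-1)^{k-2} Φ(I)` (`map_mulLeft_neg_one`, `coeffActionLite_neg_one`,
`aeval_neg_X_of_isHomogeneous`), so for odd `k - 2` one gets `2 Φ(I) = 0`, `Φ(I) = 0` in
characteristic `0`. No Hecke condition is used. [cite: Eichler1973, Ch. II §6 (B_l(n) = 0 for odd l)] -/
theorem even_of_equivariant_of_ne_zero (S : DefiniteSetupLite Nplus Nminus) {F : Type*} [Field F]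
    [Algebra ℚ F] (ι : QuaternionAlgebra ℚ S.a 0 S.b →ₐ[ℚ] Matrix (Fin 2) (Fin 2) F) {k : ℕ}
    {Φ : Submodule ℤ (QuaternionAlgebra ℚ S.a 0 S.b) → MvPolynomial (Fin 2) F}
    (hhom : ∀ I ∈ rightIdealsLite S.O, (Φ I).IsHomogeneous (k - 2))
    (hequiv : ∀ (β : (QuaternionAlgebra ℚ S.a 0 S.b)ˣ), ∀ I ∈ rightIdealsLite S.O,
        Φ (I.map (AddMonoidHom.mulLeft β.1).toIntLinearMap) = coeffActionLite ι β (Φ I))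
    (hne : ∃ I ∈ rightIdealsLite S.O, Φ I ≠ 0) :
    Even (k - 2) := by
  haveI : CharZero F := charZero_of_injective_algebraMap (algebraMap ℚ F).injective
  by_contra hodd
  rw [Nat.not_even_iff_odd] at hodd
  obtain ⟨I, hI, hΦ⟩ := hne
  apply hΦ
  have h1 := hequiv (-1) I hI
  rw [map_mulLeft_neg_one, coeffActionLite_neg_one, aeval_neg_X_of_isHomogeneous (hhom I hI),
    hodd.neg_one_pow, neg_one_smul] at h1
  -- `h1 : Φ I = -Φ I`
  have h2 : (2 : F) • Φ I = 0 := by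
    rw [two_smul]
    nth_rewrite 2 [h1]
    exact add_neg_cancel (Φ I)
  exact (smul_eq_zero.mp h2).resolve_left two_ne_zero

/-- **A weight-`k` Brandt eigen-system has `k - 2` even** (the space `S_k(O) ⊗ F` of
`Sym^{k-2}`-valued forms on the class set of a definite order is zero in odd weight, `-1 ∈ Oˣ`
acting by `(-1)^{k-2}`). [cite: Eichler1973, Ch. II §6 (B_l(n) = 0 for odd l)] -/
theorem IsWeightEigenformLite.even_sub_two {S : DefiniteSetupLite Nplus Nminus} {F : Type*}
    [Field F] [Algebra ℚ F] {ι : QuaternionAlgebra ℚ S.a 0 S.b →ₐ[ℚ] Matrix (Fin 2) (Fin 2) F}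
    {k : ℕ} {lam : ℕ → F}
    {Φ : Submodule ℤ (QuaternionAlgebra ℚ S.a 0 S.b) → MvPolynomial (Fin 2) F}
    (h : IsWeightEigenformLite S ι k lam Φ) : Even (k - 2) :=
  even_of_equivariant_of_ne_zero S ι h.1 h.2.1 h.2.2.2

/-- **Weight-`k` Brandt eigen-systems only exist in even weight `k`** (for `2 ≤ k`; below `2`
the tree's encoding `deg = k - 2` truncates to weight `2`). In particular the hypotheses of
`jacquetLanglands_newform_of_brandtEigenformLite` (`2 < k`) force `k` even, `k ≥ 4`.
[cite: Eichler1973, Ch. II §6 (B_l(n) = 0 for odd l)] [cite: DembeleVoight2013, §7 (weights of the same parity)] -/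
theorem IsWeightEigenformLite.even {S : DefiniteSetupLite Nplus Nminus} {F : Type*}
    [Field F] [Algebra ℚ F] {ι : QuaternionAlgebra ℚ S.a 0 S.b →ₐ[ℚ] Matrix (Fin 2) (Fin 2) F}
    {k : ℕ} {lam : ℕ → F}
    {Φ : Submodule ℤ (QuaternionAlgebra ℚ S.a 0 S.b) → MvPolynomial (Fin 2) F}
    (h : IsWeightEigenformLite S ι k lam Φ) (hk : 2 ≤ k) : Even k := by
  have h2 := h.even_sub_two
  have hk' : k = (k - 2) + 2 := (Nat.sub_add_cancel hk).symm
  rw [hk']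
  exact h2.add even_two

/-- **No weight-`k` Brandt eigen-systems of odd weight** (contrapositive form used to discard the
odd-weight case of `jacquetLanglands_newform_of_brandtEigenformLite`). [cite: Eichler1973, Ch. II §6 (B_l(n) = 0 for odd l)] -/
theorem not_isWeightEigenformLite_of_odd {S : DefiniteSetupLite Nplus Nminus} {F : Type*}
    [Field F] [Algebra ℚ F] (ι : QuaternionAlgebra ℚ S.a 0 S.b →ₐ[ℚ] Matrix (Fin 2) (Fin 2) F)
    {k : ℕ} (hk : 2 ≤ k) (hodd : Odd k) (lam : ℕ → F)
    (Φ : Submodule ℤ (QuaternionAlgebra ℚ S.a 0 S.b) → MvPolynomial (Fin 2) F) :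
    ¬ IsWeightEigenformLite S ι k lam Φ :=
  fun h => (Nat.not_even_iff_odd.mpr hodd) (h.even hk)

end Brandt

end Literature.NumberTheory.Automorphic

end
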